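import Mathlib
import HarnessLib
import Summits.HubbardSuperconductivity.HubbardSuperconductivity.Theorems.KLProgrammeKLRegimeEngineTowerImportP2PlainFromValues

/-!
# Route `KLProgramme` — engine support (row (X).1 / #14 «S3 IN U-CURRENCY», NORM side, brick (T2′)): the plain four-leg line from pair-transfer bumps in
# ALL THREE PAIRINGS of the pinned leg — Cooper `{0,1}{2,3}`, exchange `{0,2}{1,3}`, forward `{0,3}{1,2}` — so that a producer may superpose transfer
# profiles of every channel (pair, particle–hole at `Q ≈ 0`, particle–hole at a nesting vector) in one representation

Cell gate-hubbard-kl, seat hubbard-kl-k3c2-p3 (g16).  Sequel to `…TowerImportP2PlainFromValues` (p704772, pairing `{0,1}{2,3}` only).  The quartic increments of a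
fermionic effective action are transfer profiles in THREE channels (BGM 2006 §3: the Cooper transfer `k₁ + k₂`, the exchange and the direct particle–hole
transfers); in position space these are pair-transfer forms with the pinned leg `0` paired with leg `1`, `2` or `3`.  The fixed-tuple size is symmetric in the
three summed legs, so each pairing has the same bound; here the two missing pairings and a pairing-agnostic superposition lemma:

* §1 `sum_pairForced₂`, `sum_pairForced₃` — the pair-forced triple sums for the pairings `{0,2}{1,3}` and `{0,3}{1,2}`;
* §2 **`fixedTupleL1_le_of_pairTransfer₂/₃`**, **`fixedTupleL1_le_of_anyPairTransfer_bump`** — a kernel majorised by a pair-transfer form of a bump `G` in ANY of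
  the three pairings (a disjunction of the three majorants) has `fixedTupleL1 L M β 3 B Ω y ≤ ε_x³·c·√(10485760·n₀)·(2M·L²)·A`;
* §3 **`fixedTupleL1_le_of_anyPairTransfer_superposition`**, **`plainFourLegLine_of_anyPairTransfer_superposition`** — the assembled bound and the import-row
  shape of `EngineV8.importRowsF_of_plainLines_klEng` (`∀ s c' y₀, fixedTupleL1 … ≤ κ·√(10485760·n₀)·V + r`) for superpositions whose terms may each use a
  different pairing.

Everything is proved; no definitions, no named facts; the representation stays a hypothesis ((s1)(s2)(s3) of KL STATUS (R386)/(R390)); nothing here asserts (X).1,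
a branch, K3 or superconductivity. [folklore]  References: BGM 2006 §2.3 (2.17), §3 (3.2)–(3.6) [cite: BenfattoGiulianiMastropietro2006].
-/

noncomputable section

namespace Summit.HubbardSuperconductivity.HubbardSuperconductivity.Theorems.TorusFourierL2

set_option linter.dupNamespace false -- summit = problem name (single-conjunct summit), D-0017

open Finset Complex Literature.Probability.LatticeModels Literature.MathematicalPhysics.QuantumLattice
open Summit.HubbardSuperconductivity.HubbardSuperconductivity.Theorems.KLRegimeSplit
open scoped Real

variable {L M : ℕ} [NeZero L] [NeZero M]

/-! ### §1 The pair-forced triple sums for the other two pairings -/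

omit [NeZero L] [NeZero M] in
/-- **Pairing `{0,2}{1,3}`**: `Σ_{x : Fin 3 → Γ} [x₁ = y][x₂ = x₀]·g(x₀) = Σ_w g(w)`. [folklore] -/
theorem sum_pairForced₂ {Γ E : Type*} [Fintype Γ] [DecidableEq Γ] [AddCommMonoid E] (g : Γ → E) (y : Γ) :
    ∑ x : Fin 3 → Γ, (if x 1 = y ∧ x 2 = x 0 then g (x 0) else 0) = ∑ w, g w := by
  rw [sum_tuple_succ]
  have hc : ∀ (X : Γ) (W : Fin 2 → Γ), (if (Fin.cons X W : Fin 3 → Γ) 1 = y ∧ (Fin.cons X W : Fin 3 → Γ) 2 = (Fin.cons X W : Fin 3 → Γ) 0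
      then g ((Fin.cons X W : Fin 3 → Γ) 0) else 0) = (if W 0 = y ∧ W 1 = X then g X else 0) := fun X W => rfl
  rw [sum_congr rfl fun X _ => sum_congr rfl fun W _ => hc X W]
  refine sum_congr rfl fun X _ => ?_
  rw [sum_tuple_succ]
  have hc2 : ∀ (a : Γ) (W : Fin 1 → Γ), (if (Fin.cons a W : Fin 2 → Γ) 0 = y ∧ (Fin.cons a W : Fin 2 → Γ) 1 = X then g X else 0) =
      (if a = y ∧ W 0 = X then g X else 0) := fun a W => rfl
  rw [sum_congr rfl fun a _ => sum_congr rfl fun W _ => hc2 a W, Finset.sum_comm]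
  simp_rw [sum_ite_eq_and]
  rw [sum_tuple_one]
  show ∑ w : Γ, (if w = X then g X else 0) = g X
  rw [Finset.sum_eq_single X]
  · simp
  · intro w _ hw; simp [hw]
  · intro h; exact absurd (Finset.mem_univ X) h

omit [NeZero L] [NeZero M] in
/-- **Pairing `{0,3}{1,2}`**: `Σ_{x : Fin 3 → Γ} [x₂ = y][x₁ = x₀]·g(x₀) = Σ_w g(w)`. [folklore] -/
theorem sum_pairForced₃ {Γ E : Type*} [Fintype Γ] [DecidableEq Γ] [AddCommMonoid E] (g : Γ → E) (y : Γ) :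
    ∑ x : Fin 3 → Γ, (if x 2 = y ∧ x 1 = x 0 then g (x 0) else 0) = ∑ w, g w := by
  rw [sum_tuple_succ]
  have hc : ∀ (X : Γ) (W : Fin 2 → Γ), (if (Fin.cons X W : Fin 3 → Γ) 2 = y ∧ (Fin.cons X W : Fin 3 → Γ) 1 = (Fin.cons X W : Fin 3 → Γ) 0
      then g ((Fin.cons X W : Fin 3 → Γ) 0) else 0) = (if W 1 = y ∧ W 0 = X then g X else 0) := fun X W => rfl
  rw [sum_congr rfl fun X _ => sum_congr rfl fun W _ => hc X W]
  refine sum_congr rfl fun X _ => ?_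
  rw [sum_tuple_succ]
  have hc2 : ∀ (a : Γ) (W : Fin 1 → Γ), (if (Fin.cons a W : Fin 2 → Γ) 1 = y ∧ (Fin.cons a W : Fin 2 → Γ) 0 = X then g X else 0) =
      (if W 0 = y ∧ a = X then g X else 0) := fun a W => rfl
  rw [sum_congr rfl fun a _ => sum_congr rfl fun W _ => hc2 a W]
  have hin : ∀ a : Γ, ∑ W : Fin 1 → Γ, (if W 0 = y ∧ a = X then g X else 0) = if a = X then g X else 0 := by
    intro a
    rw [sum_tuple_one]
    show ∑ w : Γ, (if w = y ∧ a = X then g X else 0) = if a = X then g X else 0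
    exact sum_ite_eq_and y (a = X) (g X)
  simp_rw [hin]
  rw [Finset.sum_eq_single X]
  · simp
  · intro w _ hw; simp [hw]
  · intro h; exact absurd (Finset.mem_univ X) h

/-! ### §2 The other two pairings, and the pairing-agnostic bump bound -/

/-- **Pairing `{0,2}{1,3}`**: if `‖B Ω x‖ ≤ [x₂ = x₀][x₃ = x₁]·c·‖Σ_q χ_q(x₀ − x₁)•G(q)‖` then `fixedTupleL1 L M β 3 B Ω y ≤ ε_x³·c·Σ_z‖Σ_q χ_q(z)•G(q)‖`.
[cite: BenfattoGiulianiMastropietro2006, §2.3 (2.17)] -/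
theorem fixedTupleL1_le_of_pairTransfer₂ {N : ℕ} {β : ℝ} (hβ : 0 ≤ β) (B : (Fin 4 → SectorLeg N) → (Fin 4 → SpaceTimeIdx L M) → ℂ)
    (Ω : Fin 4 → SectorLeg N) (G : TorusSite 1 (2 * M) × TorusSite 2 L → ℂ) {c : ℝ}
    (hB : ∀ x : Fin 4 → SpaceTimeIdx L M, ‖B Ω x‖ ≤
      if x 2 = x 0 ∧ x 3 = x 1 then c * ‖∑ q : TorusSite 1 (2 * M) × TorusSite 2 L,
        (torusChar q.1 (fun _ : Fin 1 => (((x 0).1 : ℕ) : ZMod (2 * M)) - (((x 1).1 : ℕ) : ZMod (2 * M))) *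
          torusChar q.2 ((x 0).2 - (x 1).2)) • G q‖ else 0) (y : SpaceTimeIdx L M) :
    fixedTupleL1 L M β 3 B Ω y ≤ imagTimeWeight β M ^ 3 * (c *
      ∑ z : TorusSite 1 (2 * M) × TorusSite 2 L, ‖∑ q : TorusSite 1 (2 * M) × TorusSite 2 L, (torusChar q.1 z.1 * torusChar q.2 z.2) • G q‖) := by
  classical
  set CS : TorusSite 1 (2 * M) × TorusSite 2 L → ℝ := fun z =>
    ‖∑ q : TorusSite 1 (2 * M) × TorusSite 2 L, (torusChar q.1 z.1 * torusChar q.2 z.2) • G q‖ with hCS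
  set D : SpaceTimeIdx L M → SpaceTimeIdx L M → TorusSite 1 (2 * M) × TorusSite 2 L := fun u v =>
    ((fun _ : Fin 1 => ((u.1 : ℕ) : ZMod (2 * M)) - ((v.1 : ℕ) : ZMod (2 * M))), u.2 - v.2) with hD
  have hB' : ∀ x : Fin 4 → SpaceTimeIdx L M, ‖B Ω x‖ ≤ if x 2 = x 0 ∧ x 3 = x 1 then c * CS (D (x 0) (x 1)) else 0 := by
    intro x; simpa [hCS, hD] using hB x
  unfold fixedTupleL1
  refine mul_le_mul_of_nonneg_left ?_ (pow_nonneg (imagTimeWeight_nonneg hβ M) 3)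
  have hmaj : ∑ x : Fin 3 → SpaceTimeIdx L M, ‖B Ω (Matrix.vecCons y x)‖ ≤
      ∑ x : Fin 3 → SpaceTimeIdx L M, (if x 1 = y ∧ x 2 = x 0 then c * CS (D y (x 0)) else 0) := by
    refine sum_le_sum fun x _ => (hB' _).trans (le_of_eq ?_)
    simp only [Matrix.cons_val_zero, Matrix.cons_val_one]
    rfl
  refine hmaj.trans (le_of_eq ?_)
  calc ∑ x : Fin 3 → SpaceTimeIdx L M, (if x 1 = y ∧ x 2 = x 0 then c * CS (D y (x 0)) else 0)
      = ∑ w : SpaceTimeIdx L M, c * CS (D y w) := sum_pairForced₂ (fun w => c * CS (D y w)) y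
    _ = c * ∑ z : TorusSite 1 (2 * M) × TorusSite 2 L, CS z := by
        rw [← mul_sum]
        exact congrArg (c * ·) (sum_spaceTime_eq_sum_prodTorus (fun z => CS z) y)

/-- **Pairing `{0,3}{1,2}`**: if `‖B Ω x‖ ≤ [x₃ = x₀][x₂ = x₁]·c·‖Σ_q χ_q(x₀ − x₁)•G(q)‖` then `fixedTupleL1 L M β 3 B Ω y ≤ ε_x³·c·Σ_z‖Σ_q χ_q(z)•G(q)‖`.
[cite: BenfattoGiulianiMastropietro2006, §2.3 (2.17)] -/
theorem fixedTupleL1_le_of_pairTransfer₃ {N : ℕ} {β : ℝ} (hβ : 0 ≤ β) (B : (Fin 4 → SectorLeg N) → (Fin 4 → SpaceTimeIdx L M) → ℂ)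
    (Ω : Fin 4 → SectorLeg N) (G : TorusSite 1 (2 * M) × TorusSite 2 L → ℂ) {c : ℝ}
    (hB : ∀ x : Fin 4 → SpaceTimeIdx L M, ‖B Ω x‖ ≤
      if x 3 = x 0 ∧ x 2 = x 1 then c * ‖∑ q : TorusSite 1 (2 * M) × TorusSite 2 L,
        (torusChar q.1 (fun _ : Fin 1 => (((x 0).1 : ℕ) : ZMod (2 * M)) - (((x 1).1 : ℕ) : ZMod (2 * M))) *
          torusChar q.2 ((x 0).2 - (x 1).2)) • G q‖ else 0) (y : SpaceTimeIdx L M) :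
    fixedTupleL1 L M β 3 B Ω y ≤ imagTimeWeight β M ^ 3 * (c *
      ∑ z : TorusSite 1 (2 * M) × TorusSite 2 L, ‖∑ q : TorusSite 1 (2 * M) × TorusSite 2 L, (torusChar q.1 z.1 * torusChar q.2 z.2) • G q‖) := by
  classical
  set CS : TorusSite 1 (2 * M) × TorusSite 2 L → ℝ := fun z =>
    ‖∑ q : TorusSite 1 (2 * M) × TorusSite 2 L, (torusChar q.1 z.1 * torusChar q.2 z.2) • G q‖ with hCS
  set D : SpaceTimeIdx L M → SpaceTimeIdx L M → TorusSite 1 (2 * M) × TorusSite 2 L := fun u v =>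
    ((fun _ : Fin 1 => ((u.1 : ℕ) : ZMod (2 * M)) - ((v.1 : ℕ) : ZMod (2 * M))), u.2 - v.2) with hD
  have hB' : ∀ x : Fin 4 → SpaceTimeIdx L M, ‖B Ω x‖ ≤ if x 3 = x 0 ∧ x 2 = x 1 then c * CS (D (x 0) (x 1)) else 0 := by
    intro x; simpa [hCS, hD] using hB x
  unfold fixedTupleL1
  refine mul_le_mul_of_nonneg_left ?_ (pow_nonneg (imagTimeWeight_nonneg hβ M) 3)
  have hmaj : ∑ x : Fin 3 → SpaceTimeIdx L M, ‖B Ω (Matrix.vecCons y x)‖ ≤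
      ∑ x : Fin 3 → SpaceTimeIdx L M, (if x 2 = y ∧ x 1 = x 0 then c * CS (D y (x 0)) else 0) := by
    refine sum_le_sum fun x _ => (hB' _).trans (le_of_eq ?_)
    simp only [Matrix.cons_val_zero, Matrix.cons_val_one]
    rfl
  refine hmaj.trans (le_of_eq ?_)
  calc ∑ x : Fin 3 → SpaceTimeIdx L M, (if x 2 = y ∧ x 1 = x 0 then c * CS (D y (x 0)) else 0)
      = ∑ w : SpaceTimeIdx L M, c * CS (D y w) := sum_pairForced₃ (fun w => c * CS (D y w)) y
    _ = c * ∑ z : TorusSite 1 (2 * M) × TorusSite 2 L, CS z := by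
        rw [← mul_sum]
        exact congrArg (c * ·) (sum_spaceTime_eq_sum_prodTorus (fun z => CS z) y)

/-- **A pair-transfer bump in ANY of the three pairings has plain four-leg line `≤ ε_x³·c·√(10485760·n₀)·(2M·L²)·A`**: the majorant hypothesis is the
disjunction of the three pairings' majorants (`{0,1}{2,3}`: transfer `x₀ − x₂`; `{0,2}{1,3}` and `{0,3}{1,2}`: transfer `x₀ − x₁`), the bump data as in
`fixedTupleL1_le_of_pairTransfer_bump`. [cite: Katznelson2004, Ch. I §6.3] -/
theorem fixedTupleL1_le_of_anyPairTransfer_bump {N : ℕ} {β : ℝ} (hβ : 0 ≤ β) (B : (Fin 4 → SectorLeg N) → (Fin 4 → SpaceTimeIdx L M) → ℂ)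
    (Ω : Fin 4 → SectorLeg N) (G : TorusSite 1 (2 * M) × TorusSite 2 L → ℂ) {c : ℝ} (hc : 0 ≤ c)
    (hB : (∀ x : Fin 4 → SpaceTimeIdx L M, ‖B Ω x‖ ≤
        if x 1 = x 0 ∧ x 3 = x 2 then c * ‖∑ q : TorusSite 1 (2 * M) × TorusSite 2 L,
          (torusChar q.1 (fun _ : Fin 1 => (((x 0).1 : ℕ) : ZMod (2 * M)) - (((x 2).1 : ℕ) : ZMod (2 * M))) *
            torusChar q.2 ((x 0).2 - (x 2).2)) • G q‖ else 0) ∨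
      (∀ x : Fin 4 → SpaceTimeIdx L M, ‖B Ω x‖ ≤
        if x 2 = x 0 ∧ x 3 = x 1 then c * ‖∑ q : TorusSite 1 (2 * M) × TorusSite 2 L,
          (torusChar q.1 (fun _ : Fin 1 => (((x 0).1 : ℕ) : ZMod (2 * M)) - (((x 1).1 : ℕ) : ZMod (2 * M))) *
            torusChar q.2 ((x 0).2 - (x 1).2)) • G q‖ else 0) ∨
      (∀ x : Fin 4 → SpaceTimeIdx L M, ‖B Ω x‖ ≤
        if x 3 = x 0 ∧ x 2 = x 1 then c * ‖∑ q : TorusSite 1 (2 * M) × TorusSite 2 L,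
          (torusChar q.1 (fun _ : Fin 1 => (((x 0).1 : ℕ) : ZMod (2 * M)) - (((x 1).1 : ℕ) : ZMod (2 * M))) *
            torusChar q.2 ((x 0).2 - (x 1).2)) • G q‖ else 0))
    {s₀ s₁ : ℝ} (hs₀ : 0 < s₀) (hs₀1 : s₀ ≤ 1) (hs₁ : 0 < s₁) (hs₁1 : s₁ ≤ 1) {A : ℝ} (hA : 0 ≤ A) {Ns : ℕ} {n₀ : ℝ}
    (hn₀ : 0 ≤ n₀) (hNs : (Ns : ℝ) ≤ n₀ * (s₀ * (2 * M : ℕ)) * (s₁ * L) ^ 2)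
    (hsupp : (univ.filter fun q => G q ≠ 0).card ≤ Ns) (hsup : ∀ q, ‖G q‖ ≤ A)
    (h₀ : ∀ q, ‖(fwdDiff ((fun _ : Fin 1 => (1 : ZMod (2 * M))), (0 : TorusSite 2 L)))^[2] G q‖ ≤ A * (4 / (s₀ * (2 * M : ℕ))) ^ 2)
    (h₁ : ∀ q (i : Fin 2), ‖(fwdDiff ((0 : TorusSite 1 (2 * M)), (Pi.single i (1 : ZMod L) : TorusSite 2 L)))^[2] G q‖ ≤
      A * (4 / (s₁ * L)) ^ 2) (y : SpaceTimeIdx L M) :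
    fixedTupleL1 L M β 3 B Ω y ≤ imagTimeWeight β M ^ 3 * (c * (Real.sqrt (10485760 * n₀) * (((2 * M : ℕ) : ℝ) * (L : ℝ) ^ 2) * A)) := by
  have hε : 0 ≤ imagTimeWeight β M ^ 3 := pow_nonneg (imagTimeWeight_nonneg hβ M) 3
  have hbump := sum_norm_charSum_bump_le (P := 2 * M) G hs₀ hs₀1 hs₁ hs₁1 hA hn₀ hNs hsupp hsup h₀ h₁
  rcases hB with h | h | h
  · exact (fixedTupleL1_le_of_pairTransfer hβ B Ω G h y).trans
      (mul_le_mul_of_nonneg_left (mul_le_mul_of_nonneg_left hbump hc) hε)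
  · exact (fixedTupleL1_le_of_pairTransfer₂ hβ B Ω G h y).trans
      (mul_le_mul_of_nonneg_left (mul_le_mul_of_nonneg_left hbump hc) hε)
  · exact (fixedTupleL1_le_of_pairTransfer₃ hβ B Ω G h y).trans
      (mul_le_mul_of_nonneg_left (mul_le_mul_of_nonneg_left hbump hc) hε)

/-! ### §3 Superpositions mixing the pairings, and the import-row shape -/

/-- **The plain four-leg line of a superposition of pair-transfer bumps in arbitrary pairings**: `W Ω = Σ_{i∈S} a_i·B_i + R`, each `B_i` majorised in one of
the three pairings by a bump `G_i` (rates `(s₀ⁱ,s₁ⁱ) ∈ (0,1]²`, size `A_i`, support `≤ n₀(s₀ⁱ·2M)(s₁ⁱL)²`, common normalisation `c ≥ 0`) ⟹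
`fixedTupleL1(W) Ω y ≤ ε_x³·c·√(10485760·n₀)·(2M·L²)·Σ_i ‖a_i‖·A_i + fixedTupleL1(R) Ω y`. [cite: Katznelson2004, Ch. I §6.3] -/
theorem fixedTupleL1_le_of_anyPairTransfer_superposition {ι : Type*} {N : ℕ} {β : ℝ} (hβ : 0 ≤ β) (S : Finset ι) (a : ι → ℂ)
    (W R : (Fin 4 → SectorLeg N) → (Fin 4 → SpaceTimeIdx L M) → ℂ) (B : ι → (Fin 4 → SectorLeg N) → (Fin 4 → SpaceTimeIdx L M) → ℂ)
    (Ω : Fin 4 → SectorLeg N) (hW : ∀ x, W Ω x = ∑ i ∈ S, a i * B i Ω x + R Ω x)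
    (G : ι → TorusSite 1 (2 * M) × TorusSite 2 L → ℂ) {c : ℝ} (hc : 0 ≤ c)
    (hB : ∀ i ∈ S,
      (∀ x : Fin 4 → SpaceTimeIdx L M, ‖B i Ω x‖ ≤
        if x 1 = x 0 ∧ x 3 = x 2 then c * ‖∑ q : TorusSite 1 (2 * M) × TorusSite 2 L,
          (torusChar q.1 (fun _ : Fin 1 => (((x 0).1 : ℕ) : ZMod (2 * M)) - (((x 2).1 : ℕ) : ZMod (2 * M))) *
            torusChar q.2 ((x 0).2 - (x 2).2)) • G i q‖ else 0) ∨
      (∀ x : Fin 4 → SpaceTimeIdx L M, ‖B i Ω x‖ ≤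
        if x 2 = x 0 ∧ x 3 = x 1 then c * ‖∑ q : TorusSite 1 (2 * M) × TorusSite 2 L,
          (torusChar q.1 (fun _ : Fin 1 => (((x 0).1 : ℕ) : ZMod (2 * M)) - (((x 1).1 : ℕ) : ZMod (2 * M))) *
            torusChar q.2 ((x 0).2 - (x 1).2)) • G i q‖ else 0) ∨
      (∀ x : Fin 4 → SpaceTimeIdx L M, ‖B i Ω x‖ ≤
        if x 3 = x 0 ∧ x 2 = x 1 then c * ‖∑ q : TorusSite 1 (2 * M) × TorusSite 2 L,
          (torusChar q.1 (fun _ : Fin 1 => (((x 0).1 : ℕ) : ZMod (2 * M)) - (((x 1).1 : ℕ) : ZMod (2 * M))) *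
            torusChar q.2 ((x 0).2 - (x 1).2)) • G i q‖ else 0))
    (s₀ s₁ A : ι → ℝ) (Ns : ι → ℕ) {n₀ : ℝ} (hn₀ : 0 ≤ n₀)
    (hs₀ : ∀ i ∈ S, 0 < s₀ i) (hs₀1 : ∀ i ∈ S, s₀ i ≤ 1) (hs₁ : ∀ i ∈ S, 0 < s₁ i) (hs₁1 : ∀ i ∈ S, s₁ i ≤ 1)
    (hA : ∀ i ∈ S, 0 ≤ A i) (hNs : ∀ i ∈ S, (Ns i : ℝ) ≤ n₀ * (s₀ i * (2 * M : ℕ)) * (s₁ i * L) ^ 2)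
    (hsupp : ∀ i ∈ S, (univ.filter fun q => G i q ≠ 0).card ≤ Ns i) (hsup : ∀ i ∈ S, ∀ q, ‖G i q‖ ≤ A i)
    (h₀ : ∀ i ∈ S, ∀ q, ‖(fwdDiff ((fun _ : Fin 1 => (1 : ZMod (2 * M))), (0 : TorusSite 2 L)))^[2] (G i) q‖ ≤
      A i * (4 / (s₀ i * (2 * M : ℕ))) ^ 2)
    (h₁ : ∀ i ∈ S, ∀ q (j : Fin 2), ‖(fwdDiff ((0 : TorusSite 1 (2 * M)), (Pi.single j (1 : ZMod L) : TorusSite 2 L)))^[2] (G i) q‖ ≤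
      A i * (4 / (s₁ i * L)) ^ 2) (y : SpaceTimeIdx L M) :
    fixedTupleL1 L M β 3 W Ω y ≤ imagTimeWeight β M ^ 3 * (c * (Real.sqrt (10485760 * n₀) * (((2 * M : ℕ) : ℝ) * (L : ℝ) ^ 2))) *
        ∑ i ∈ S, ‖a i‖ * A i + fixedTupleL1 L M β 3 R Ω y := by
  refine (fixedTupleL1_le_of_superposition hβ S a W R B Ω hW y).trans (add_le_add ?_ le_rfl)
  rw [mul_sum]
  refine sum_le_sum fun i hi => ?_
  have hb := fixedTupleL1_le_of_anyPairTransfer_bump hβ (B i) Ω (G i) hc (hB i hi) (hs₀ i hi) (hs₀1 i hi) (hs₁ i hi) (hs₁1 i hi)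
    (hA i hi) hn₀ (hNs i hi) (hsupp i hi) (hsup i hi) (h₀ i hi) (h₁ i hi) y
  calc ‖a i‖ * fixedTupleL1 L M β 3 (B i) Ω y
      ≤ ‖a i‖ * (imagTimeWeight β M ^ 3 * (c * (Real.sqrt (10485760 * n₀) * (((2 * M : ℕ) : ℝ) * (L : ℝ) ^ 2) * A i))) :=
        mul_le_mul_of_nonneg_left hb (norm_nonneg _)
    _ = _ := by ring

/-- **The import-row shape, pairing-agnostic**: as `plainFourLegLine_of_pairTransfer_superposition`, with each term of the representation allowed its own pairing:
`∀ s c' y₀, fixedTupleL1 L M β 3 (sectorisedKernel … trivialMultiplier 𝒱 4) ((0,s),c') y₀ ≤ κ·√(10485760·n₀)·V + r`. [cite: BenfattoGiulianiMastropietro2006, §3 (3.65)] -/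
theorem plainFourLegLine_of_anyPairTransfer_superposition {ι : Type*} {β : ℝ} (hβ : 0 ≤ β) (𝒱 : HubbardGrassmann L M)
    (S : Finset ι) (a : (Fin 4 → Fin 2) → (Fin 4 → Fin 2) → ι → ℂ)
    (B : (Fin 4 → Fin 2) → (Fin 4 → Fin 2) → ι → (Fin 4 → SectorLeg 1) → (Fin 4 → SpaceTimeIdx L M) → ℂ)
    (R : (Fin 4 → Fin 2) → (Fin 4 → Fin 2) → (Fin 4 → SectorLeg 1) → (Fin 4 → SpaceTimeIdx L M) → ℂ)
    (G : (Fin 4 → Fin 2) → (Fin 4 → Fin 2) → ι → TorusSite 1 (2 * M) × TorusSite 2 L → ℂ) {c : ℝ} (hc : 0 ≤ c)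
    (s₀ s₁ A : (Fin 4 → Fin 2) → (Fin 4 → Fin 2) → ι → ℝ) (Ns : (Fin 4 → Fin 2) → (Fin 4 → Fin 2) → ι → ℕ)
    {n₀ V r κ : ℝ} (hn₀ : 0 ≤ n₀)
    (hW : ∀ (s c' : Fin 4 → Fin 2) (x : Fin 4 → SpaceTimeIdx L M),
      sectorisedKernel L M β (trivialMultiplier L M) 𝒱 4 (fun i => (((0 : Fin 1), s i), c' i)) x =
        ∑ i ∈ S, a s c' i * B s c' i (fun i => (((0 : Fin 1), s i), c' i)) x + R s c' (fun i => (((0 : Fin 1), s i), c' i)) x)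
    (hB : ∀ (s c' : Fin 4 → Fin 2), ∀ i ∈ S,
      (∀ x : Fin 4 → SpaceTimeIdx L M, ‖B s c' i (fun i => (((0 : Fin 1), s i), c' i)) x‖ ≤
        if x 1 = x 0 ∧ x 3 = x 2 then c * ‖∑ q : TorusSite 1 (2 * M) × TorusSite 2 L,
          (torusChar q.1 (fun _ : Fin 1 => (((x 0).1 : ℕ) : ZMod (2 * M)) - (((x 2).1 : ℕ) : ZMod (2 * M))) *
            torusChar q.2 ((x 0).2 - (x 2).2)) • G s c' i q‖ else 0) ∨
      (∀ x : Fin 4 → SpaceTimeIdx L M, ‖B s c' i (fun i => (((0 : Fin 1), s i), c' i)) x‖ ≤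
        if x 2 = x 0 ∧ x 3 = x 1 then c * ‖∑ q : TorusSite 1 (2 * M) × TorusSite 2 L,
          (torusChar q.1 (fun _ : Fin 1 => (((x 0).1 : ℕ) : ZMod (2 * M)) - (((x 1).1 : ℕ) : ZMod (2 * M))) *
            torusChar q.2 ((x 0).2 - (x 1).2)) • G s c' i q‖ else 0) ∨
      (∀ x : Fin 4 → SpaceTimeIdx L M, ‖B s c' i (fun i => (((0 : Fin 1), s i), c' i)) x‖ ≤
        if x 3 = x 0 ∧ x 2 = x 1 then c * ‖∑ q : TorusSite 1 (2 * M) × TorusSite 2 L,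
          (torusChar q.1 (fun _ : Fin 1 => (((x 0).1 : ℕ) : ZMod (2 * M)) - (((x 1).1 : ℕ) : ZMod (2 * M))) *
            torusChar q.2 ((x 0).2 - (x 1).2)) • G s c' i q‖ else 0))
    (hs₀ : ∀ s c', ∀ i ∈ S, 0 < s₀ s c' i) (hs₀1 : ∀ s c', ∀ i ∈ S, s₀ s c' i ≤ 1)
    (hs₁ : ∀ s c', ∀ i ∈ S, 0 < s₁ s c' i) (hs₁1 : ∀ s c', ∀ i ∈ S, s₁ s c' i ≤ 1) (hA : ∀ s c', ∀ i ∈ S, 0 ≤ A s c' i)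
    (hNs : ∀ s c', ∀ i ∈ S, (Ns s c' i : ℝ) ≤ n₀ * (s₀ s c' i * (2 * M : ℕ)) * (s₁ s c' i * L) ^ 2)
    (hsupp : ∀ s c', ∀ i ∈ S, (univ.filter fun q => G s c' i q ≠ 0).card ≤ Ns s c' i)
    (hsup : ∀ s c', ∀ i ∈ S, ∀ q, ‖G s c' i q‖ ≤ A s c' i)
    (h₀ : ∀ s c', ∀ i ∈ S, ∀ q, ‖(fwdDiff ((fun _ : Fin 1 => (1 : ZMod (2 * M))), (0 : TorusSite 2 L)))^[2] (G s c' i) q‖ ≤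
      A s c' i * (4 / (s₀ s c' i * (2 * M : ℕ))) ^ 2)
    (h₁ : ∀ s c', ∀ i ∈ S, ∀ q (j : Fin 2),
      ‖(fwdDiff ((0 : TorusSite 1 (2 * M)), (Pi.single j (1 : ZMod L) : TorusSite 2 L)))^[2] (G s c' i) q‖ ≤ A s c' i * (4 / (s₁ s c' i * L)) ^ 2)
    (hV : ∀ s c', ∑ i ∈ S, ‖a s c' i‖ * A s c' i ≤ V)
    (hr : ∀ (s c' : Fin 4 → Fin 2) (y₀ : SpaceTimeIdx L M), fixedTupleL1 L M β 3 (R s c') (fun i => (((0 : Fin 1), s i), c' i)) y₀ ≤ r)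
    (hκ : imagTimeWeight β M ^ 3 * (c * (((2 * M : ℕ) : ℝ) * (L : ℝ) ^ 2)) ≤ κ) :
    ∀ (s c' : Fin 4 → Fin 2) (y₀ : SpaceTimeIdx L M),
      fixedTupleL1 L M β 3 (sectorisedKernel L M β (trivialMultiplier L M) 𝒱 4) (fun i => (((0 : Fin 1), s i), c' i)) y₀ ≤
        κ * Real.sqrt (10485760 * n₀) * V + r := by
  intro s c' y₀
  have h := fixedTupleL1_le_of_anyPairTransfer_superposition hβ S (a s c') (sectorisedKernel L M β (trivialMultiplier L M) 𝒱 4) (R s c')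
    (B s c') (fun i => (((0 : Fin 1), s i), c' i)) (hW s c') (G s c') hc (hB s c') (s₀ s c') (s₁ s c') (A s c') (Ns s c') hn₀
    (hs₀ s c') (hs₀1 s c') (hs₁ s c') (hs₁1 s c') (hA s c') (hNs s c') (hsupp s c') (hsup s c') (h₀ s c') (h₁ s c') y₀
  refine h.trans (add_le_add ?_ (hr s c' y₀))
  have hsq : 0 ≤ Real.sqrt (10485760 * n₀) := Real.sqrt_nonneg _
  have hVs : 0 ≤ ∑ i ∈ S, ‖a s c' i‖ * A s c' i := sum_nonneg fun i hi => mul_nonneg (norm_nonneg _) (hA s c' i hi)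
  have hε : 0 ≤ imagTimeWeight β M ^ 3 * (c * (((2 * M : ℕ) : ℝ) * (L : ℝ) ^ 2)) := by
    have := imagTimeWeight_nonneg hβ M; positivity
  calc imagTimeWeight β M ^ 3 * (c * (Real.sqrt (10485760 * n₀) * (((2 * M : ℕ) : ℝ) * (L : ℝ) ^ 2))) * ∑ i ∈ S, ‖a s c' i‖ * A s c' i
      = (imagTimeWeight β M ^ 3 * (c * (((2 * M : ℕ) : ℝ) * (L : ℝ) ^ 2))) * Real.sqrt (10485760 * n₀) *
          ∑ i ∈ S, ‖a s c' i‖ * A s c' i := by ring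
    _ ≤ κ * Real.sqrt (10485760 * n₀) * V :=
        mul_le_mul (mul_le_mul_of_nonneg_right hκ hsq) (hV s c') hVs (mul_nonneg (hε.trans hκ) hsq)

end Summit.HubbardSuperconductivity.HubbardSuperconductivity.Theorems.TorusFourierL2

end
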